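import Summits.HodgeConjecture.CorCM.Census.CentralSquaresMixedFace

/-!
# The square-central class, XXVII: the stabiliser relation of the mixed face IN COORDINATES — `Y_h − Y'_{h·g₁⁻¹} ∈ L`

COR-CM (cell `pub-hodgecm2`), count-neutral kernel combinatorics by the binder seat b09 (gen 46; lane SQUARE-CENTRAL CLASS, part XXVII), on part XXVI
(`mixed_face_stabiliser_relation`) and part IIʼs flip calculus (`defect_oflipCM_of_not_mem`, `oflipCM_rt_self`) BY NAME.  Theorems only: no definition,
no `decide`, no certificate, no named fact, no `sorry`.  HONEST FRAMING: `HC_CM` is NOT proved, here or anywhere in the tree; nothing here is a period or a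
headline.

Part XXVIʼs relation is `W = (θ_{T̄₁} − θ_{T₁})(typeSum [Φ]) − (θ_{T̄₀} − θ_{T₁})(typeSum [Φ^{(h)}]) + (θ_{T̄₀} − θ_{T̄₁})(typeSum [Φ^{(κ)}])` with `κ = h·g₁⁻¹`.
Relative to each of the three base types involved, the flipped place is a DEVIATION place of `Φ` (`c·h ∈ T₁ ∖ Φ`, `c·h ∈ T̄₀ ∖ Φ`, `c·κ ∈ T̄₀ ∖ Φ`,
`c·κ ∈ T̄₁ ∖ Φ`), so each star form of a flipped type is the star form of `Φ` minus one flip class (§1 `thetaG_typeSum_oflipCM_of_not_mem`), all star forms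
of `Φ` cancel, and modulo pairs (`[T̄^{(s)}] = pair − [T^{(s)}]`)
`W = (Y'_κ − Y_h) + pair(T₀^{(h)}) − pair(T₀^{(κ)}) + pair(T₁^{(κ)}) − pair(T₁)` EXACTLY (§2 `stabiliser_relation_coords`), where
`Y_s = (f_s − e₀) + (g_s − e₁)`, `Y'_s = (f_s − e₀) − (g_s − e₁)`.  Hence **`Y_h − Y'_{h·g₁⁻¹} ∈ L`** (§2 `Y_sub_Y'_mem_of_mixed_face`) — the one new near
relation of the order-`4` rows (`ℤ/4 ⋊ ℤ/4`; design note `CENTRAL-SQUARES-M2.md` §5: numerically `Y_{h₀} − Y'_{k₁}`), whose translates give `Y − Y_ζ`,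
`2(Y_h − Y_{σh})`, `4Y`, `4Y'` (part XXVIII).

## References
* [Pohlmann1968] H. Pohlmann, Algebraic cycles on abelian varieties of complex multiplication type, Ann. of Math. 88 (1968), Thm 1.
-/

namespace Summit.HodgeConjecture.CorCM.Census.CentralSquares

open Finset
open scoped symmDiff
open Summit.HodgeConjecture.CorCM.Prior.AllgGroup.RfwfAllgGroup
open Summit.HodgeConjecture.CorCM.Census.BlockParity
open Summit.HodgeConjecture.CorCM.Census.Coinvariant
open Summit.HodgeConjecture.CorCM.Census.TwistGeneration
open Summit.HodgeConjecture.CorCM.Census.BaseBlock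
open Summit.HodgeConjecture.CorCM.Census.CoverClosure

noncomputable section

variable {G : Type*} [Group G] [Fintype G] [DecidableEq G] (c : G)

/-! ## §1 Star forms under a flip at a deviation place -/

/-- **Star form of a flip at a deviation place** (`s ∈ B ∖ X`): `θ_B(typeSum [X^{(s)}]) = θ_B(typeSum [X]) − ([B^{(s)}] − [B])` — part IIʼs
`defect_oflipCM_of_not_mem` solved for the star form. [folklore] -/
theorem thetaG_typeSum_oflipCM_of_not_mem (hc2 : c * c = 1) (B X : CMF G c) {s : G} (hsB : s ∈ B.1) (hsX : s ∉ X.1) :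
    thetaG c hc2 B (typeSum G c (Finsupp.single (oflipCM c hc2 s X) 1)) =
      thetaG c hc2 B (typeSum G c (Finsupp.single X 1)) - (Finsupp.single (oflipCM c hc2 s B) 1 - Finsupp.single B 1) := by
  have h := defect_oflipCM_of_not_mem c hc2 B X hsB hsX
  calc thetaG c hc2 B (typeSum G c (Finsupp.single (oflipCM c hc2 s X) 1))
      = Finsupp.single (oflipCM c hc2 s X) 1 -
          (Finsupp.single (oflipCM c hc2 s X) 1 - thetaG c hc2 B (typeSum G c (Finsupp.single (oflipCM c hc2 s X) 1))) := by abel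
    _ = Finsupp.single (oflipCM c hc2 s X) 1 -
          ((Finsupp.single X 1 - thetaG c hc2 B (typeSum G c (Finsupp.single X 1))) +
            (Finsupp.single (oflipCM c hc2 s X) 1 - Finsupp.single X 1) + (Finsupp.single (oflipCM c hc2 s B) 1 - Finsupp.single B 1)) := by
        rw [h]
    _ = thetaG c hc2 B (typeSum G c (Finsupp.single X 1)) - (Finsupp.single (oflipCM c hc2 s B) 1 - Finsupp.single B 1) := by abel

section Frame

variable (hc2 : c * c = 1) (hcen : ∀ x : G, x * c = c * x) (T₀ T₁ : CMF G c)
variable (hbase : ∀ Q : G, rt c Q T₀ = T₀ ∨ rt c Q T₀ = rt c c T₀ ∨ rt c Q T₀ = T₁ ∨ rt c Q T₀ = rt c c T₁)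
variable (m : ℕ) (hn : T₀.1.card = 4 * m) (hH : (T₀.1 \ T₁.1).card = 2 * m)
variable (Q : G) (hQ : rt c Q T₀ = T₁)
variable (L : Submodule ℤ (CMF G c →₀ ℤ)) (hLrt : ∀ (Q' : G) (y : CMF G c →₀ ℤ), y ∈ L → Finsupp.mapDomain (rt c Q') y ∈ L)
variable (hcover : ∀ Ψ : CMF G c, 2 ≤ bpot c T₀ Ψ → ∃ Q₂ s s' : G, bpot c T₀ Ψ = ddist (rt c Q₂ T₀) Ψ ∧
    s ∈ (rt c Q₂ T₀).1 \ Ψ.1 ∧ s' ∈ (rt c Q₂ T₀).1 \ Ψ.1 ∧ s ≠ s' ∧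
    gface c hc2 Ψ s s' ∈ L ∧
    ((∃ Q₁ t t' : G, bpot c T₀ Ψ = ddist (rt c Q₁ T₀) Ψ ∧ t ∈ (rt c Q₁ T₀).1 \ Ψ.1 ∧ t' ∈ (rt c Q₁ T₀).1 \ Ψ.1 ∧ t ≠ t' ∧
        (∀ Q' : G, ddist (rt c Q' T₀) (oflipCM c hc2 t Ψ) = bpot c T₀ (oflipCM c hc2 t Ψ) → rt c Q' T₀ = rt c Q₁ T₀) ∧
        (∀ Q' : G, ddist (rt c Q' T₀) (oflipCM c hc2 t' Ψ) = bpot c T₀ (oflipCM c hc2 t' Ψ) → rt c Q' T₀ = rt c Q₁ T₀) ∧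
        (∀ Q' : G, ddist (rt c Q' T₀) (oflipCM c hc2 t (oflipCM c hc2 t' Ψ)) = bpot c T₀ (oflipCM c hc2 t (oflipCM c hc2 t' Ψ)) →
          rt c Q' T₀ = rt c Q₁ T₀)) →
      (∀ Q' : G, ddist (rt c Q' T₀) (oflipCM c hc2 s Ψ) = bpot c T₀ (oflipCM c hc2 s Ψ) → rt c Q' T₀ = rt c Q₂ T₀) ∧
      (∀ Q' : G, ddist (rt c Q' T₀) (oflipCM c hc2 s' Ψ) = bpot c T₀ (oflipCM c hc2 s' Ψ) → rt c Q' T₀ = rt c Q₂ T₀) ∧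
      (∀ Q' : G, ddist (rt c Q' T₀) (oflipCM c hc2 s (oflipCM c hc2 s' Ψ)) = bpot c T₀ (oflipCM c hc2 s (oflipCM c hc2 s' Ψ)) →
        rt c Q' T₀ = rt c Q₂ T₀)))

/-! ## §2 The stabiliser relation in coordinates -/

include hcen hbase hn hH hQ hLrt hcover in
/-- **THE STABILISER RELATION IN COORDINATES** (`m = 2`).  In the situation of part XXVIʼs `mixed_face_stabiliser_relation` (`κ = h·g₁⁻¹`):
`W = ((f_κ − e₀) − (g_κ − e₁)) − ((f_h − e₀) + (g_h − e₁)) + pair(T₀^{(h)}) − pair(T₀^{(κ)}) + pair(T₁^{(κ)}) − pair(T₁)` lies in `L`. [folklore] -/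
theorem stabiliser_relation_coords (hm : m = 2) (T A : Finset G) (hTH : T ⊆ T₀.1 \ T₁.1) (hA : A ⊆ T₀.1 ∩ T₁.1)
    (Φ : CMF G c) (hΦ : T₀.1 \ Φ.1 = T ∪ A)
    {k k'' : G} (hAe : A = {k, k''}) (hkk'' : k ≠ k'')
    {h h'' : G} (hHe : (T₀.1 \ T₁.1) \ T = {h, h''}) (hhh'' : h ≠ h'')
    {k' k''' : G} (hAce : (T₀.1 ∩ T₁.1) \ A = {k', k'''}) (hk'k''' : k' ≠ k''')
    (hF : gface c hc2 Φ k h ∈ L) (hFk : gface c hc2 (oflipCM c hc2 k Φ) h h'' ∈ L)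
    (hFh : gface c hc2 (oflipCM c hc2 h Φ) k' k''' ∈ L)
    (g₁ : G) (hg₀ : rt c g₁ T₀ = T₀) (hg₁ : rt c g₁ T₁ = rt c c T₁) (hgΦ : rt c g₁ Φ = Φ) :
    ((Finsupp.single (oflipCM c hc2 (h * g₁⁻¹) T₀) (1 : ℤ) - Finsupp.single T₀ 1) -
        (Finsupp.single (oflipCM c hc2 (h * g₁⁻¹) T₁) (1 : ℤ) - Finsupp.single T₁ 1)) -
      ((Finsupp.single (oflipCM c hc2 h T₀) (1 : ℤ) - Finsupp.single T₀ 1) + (Finsupp.single (oflipCM c hc2 h T₁) (1 : ℤ) - Finsupp.single T₁ 1)) +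
      (pair c (oflipCM c hc2 h T₀) - pair c (oflipCM c hc2 (h * g₁⁻¹) T₀) + pair c (oflipCM c hc2 (h * g₁⁻¹) T₁) - pair c T₁) ∈ L := by
  have hW := mixed_face_stabiliser_relation c hc2 hcen T₀ T₁ hbase m hn hH Q hQ L hLrt hcover hm T A hTH hA Φ hΦ hAe hkk'' hHe hhh'' hAce hk'k'''
    hF hFk hFh g₁ hg₀ hg₁ hgΦ
  -- the places
  have hh : h ∈ (T₀.1 \ T₁.1) \ T := by rw [hHe]; exact mem_insert_self _ _
  have hh0 : h ∈ T₀.1 := (mem_sdiff.mp (mem_sdiff.mp hh).1).1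
  have hh1 : h ∉ T₁.1 := (mem_sdiff.mp (mem_sdiff.mp hh).1).2
  have hhΦ : h ∈ Φ.1 := by
    by_contra hc'
    have h0 : h ∈ T₀.1 \ Φ.1 := mem_sdiff.mpr ⟨hh0, hc'⟩
    rw [hΦ, mem_union] at h0
    rcases h0 with hT | hAm
    · exact (mem_sdiff.mp hh).2 hT
    · exact hh1 (mem_inter.mp (hA hAm)).2
  have hch1 : c * h ∈ T₁.1 := by by_contra hc'; exact hh1 ((T₁.2 h).mpr hc')
  have hch0 : c * h ∉ T₀.1 := (T₀.2 h).mp hh0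
  have hchΦ : c * h ∉ Φ.1 := (Φ.2 h).mp hhΦ
  have hch0c : c * h ∈ (rt c c T₀).1 := (mem_compl_type_iff c hcen T₀ (c * h)).mpr hch0
  have hκ0 : h * g₁⁻¹ ∈ T₀.1 := by
    have e : h * g₁⁻¹ ∈ (rt c g₁ T₀).1 := by rw [mem_rt, inv_mul_cancel_right]; exact hh0
    rwa [hg₀] at e
  have hκΦ : h * g₁⁻¹ ∈ Φ.1 := by
    have e : h * g₁⁻¹ ∈ (rt c g₁ Φ).1 := by rw [mem_rt, inv_mul_cancel_right]; exact hhΦ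
    rwa [hgΦ] at e
  have hκ1 : h * g₁⁻¹ ∈ T₁.1 := by
    by_contra hc'
    have e : h * g₁⁻¹ ∈ (rt c c T₁).1 := (mem_compl_type_iff c hcen T₁ _).mpr hc'
    rw [← hg₁, mem_rt, inv_mul_cancel_right] at e
    exact hh1 e
  have hcκ0 : c * (h * g₁⁻¹) ∉ T₀.1 := (T₀.2 _).mp hκ0
  have hcκ1 : c * (h * g₁⁻¹) ∉ T₁.1 := (T₁.2 _).mp hκ1
  have hcκΦ : c * (h * g₁⁻¹) ∉ Φ.1 := (Φ.2 _).mp hκΦ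
  have hcκ0c : c * (h * g₁⁻¹) ∈ (rt c c T₀).1 := (mem_compl_type_iff c hcen T₀ _).mpr hcκ0
  have hcκ1c : c * (h * g₁⁻¹) ∈ (rt c c T₁).1 := (mem_compl_type_iff c hcen T₁ _).mpr hcκ1
  -- the four flips, each at a deviation place of `Φ` for the base type in question
  have e1 : oflipCM c hc2 h Φ = oflipCM c hc2 (c * h) Φ := (oflipCM_cmul c hc2 h Φ).symm
  have e2 : oflipCM c hc2 (h * g₁⁻¹) Φ = oflipCM c hc2 (c * (h * g₁⁻¹)) Φ := (oflipCM_cmul c hc2 _ Φ).symm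
  have hsr : ∀ X : CMF G c, Finsupp.single (rt c c X) (1 : ℤ) = pair c X - Finsupp.single X 1 := fun X => by
    rw [pair, add_sub_cancel_left]
  rw [e1, thetaG_typeSum_oflipCM_of_not_mem c hc2 T₁ Φ hch1 hchΦ, thetaG_typeSum_oflipCM_of_not_mem c hc2 (rt c c T₀) Φ hch0c hchΦ,
    e2, thetaG_typeSum_oflipCM_of_not_mem c hc2 (rt c c T₀) Φ hcκ0c hcκΦ,
    thetaG_typeSum_oflipCM_of_not_mem c hc2 (rt c c T₁) Φ hcκ1c hcκΦ] at hW
  simp only [oflipCM_cmul, oflipCM_rt_self c hc2 hcen, hsr] at hW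
  have e : ((Finsupp.single (oflipCM c hc2 (h * g₁⁻¹) T₀) (1 : ℤ) - Finsupp.single T₀ 1) -
        (Finsupp.single (oflipCM c hc2 (h * g₁⁻¹) T₁) (1 : ℤ) - Finsupp.single T₁ 1)) -
      ((Finsupp.single (oflipCM c hc2 h T₀) (1 : ℤ) - Finsupp.single T₀ 1) + (Finsupp.single (oflipCM c hc2 h T₁) (1 : ℤ) - Finsupp.single T₁ 1)) +
      (pair c (oflipCM c hc2 h T₀) - pair c (oflipCM c hc2 (h * g₁⁻¹) T₀) + pair c (oflipCM c hc2 (h * g₁⁻¹) T₁) - pair c T₁) =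
      thetaG c hc2 (rt c c T₁) (typeSum G c (Finsupp.single Φ 1)) - thetaG c hc2 T₁ (typeSum G c (Finsupp.single Φ 1)) -
        (thetaG c hc2 (rt c c T₀) (typeSum G c (Finsupp.single Φ 1)) -
            (pair c (oflipCM c hc2 h T₀) - Finsupp.single (oflipCM c hc2 h T₀) 1 - (pair c T₀ - Finsupp.single T₀ 1)) -
          (thetaG c hc2 T₁ (typeSum G c (Finsupp.single Φ 1)) - (Finsupp.single (oflipCM c hc2 h T₁) 1 - Finsupp.single T₁ 1))) +
        (thetaG c hc2 (rt c c T₀) (typeSum G c (Finsupp.single Φ 1)) -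
            (pair c (oflipCM c hc2 (h * g₁⁻¹) T₀) - Finsupp.single (oflipCM c hc2 (h * g₁⁻¹) T₀) 1 - (pair c T₀ - Finsupp.single T₀ 1)) -
          (thetaG c hc2 (rt c c T₁) (typeSum G c (Finsupp.single Φ 1)) -
            (pair c (oflipCM c hc2 (h * g₁⁻¹) T₁) - Finsupp.single (oflipCM c hc2 (h * g₁⁻¹) T₁) 1 - (pair c T₁ - Finsupp.single T₁ 1)))) := by
    abel
  rw [e]
  exact hW

include hcen hbase hn hH hQ hLrt hcover in
/-- **`Y_h − Y'_{h·g₁⁻¹} ∈ L`** (`m = 2`, pairs in `L`): the ONE new near relation of the order-`4` swap rows, from the mixed designated face of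
`Φ = {T ∣ A}` at the places of `k, h`, the prescribed strict faces of its two tie corners, and an element `g₁` stabilising `T₀` and `Φ` and carrying `T₁`
to `T̄₁`: `((f_h − e₀) + (g_h − e₁)) − ((f_κ − e₀) − (g_κ − e₁)) ∈ L`, `κ = h·g₁⁻¹`. [folklore] -/
theorem Y_sub_Y'_mem_of_mixed_face (hP : ∀ Ψ : CMF G c, pair c Ψ ∈ L) (hm : m = 2) (T A : Finset G) (hTH : T ⊆ T₀.1 \ T₁.1)
    (hA : A ⊆ T₀.1 ∩ T₁.1) (Φ : CMF G c) (hΦ : T₀.1 \ Φ.1 = T ∪ A)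
    {k k'' : G} (hAe : A = {k, k''}) (hkk'' : k ≠ k'')
    {h h'' : G} (hHe : (T₀.1 \ T₁.1) \ T = {h, h''}) (hhh'' : h ≠ h'')
    {k' k''' : G} (hAce : (T₀.1 ∩ T₁.1) \ A = {k', k'''}) (hk'k''' : k' ≠ k''')
    (hF : gface c hc2 Φ k h ∈ L) (hFk : gface c hc2 (oflipCM c hc2 k Φ) h h'' ∈ L)
    (hFh : gface c hc2 (oflipCM c hc2 h Φ) k' k''' ∈ L)
    (g₁ : G) (hg₀ : rt c g₁ T₀ = T₀) (hg₁ : rt c g₁ T₁ = rt c c T₁) (hgΦ : rt c g₁ Φ = Φ) :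
    ((Finsupp.single (oflipCM c hc2 h T₀) (1 : ℤ) - Finsupp.single T₀ 1) + (Finsupp.single (oflipCM c hc2 h T₁) (1 : ℤ) - Finsupp.single T₁ 1)) -
      ((Finsupp.single (oflipCM c hc2 (h * g₁⁻¹) T₀) (1 : ℤ) - Finsupp.single T₀ 1) -
        (Finsupp.single (oflipCM c hc2 (h * g₁⁻¹) T₁) (1 : ℤ) - Finsupp.single T₁ 1)) ∈ L := by
  have hW := stabiliser_relation_coords c hc2 hcen T₀ T₁ hbase m hn hH Q hQ L hLrt hcover hm T A hTH hA Φ hΦ hAe hkk'' hHe hhh'' hAce hk'k''' hF hFk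
    hFh g₁ hg₀ hg₁ hgΦ
  have hpairs : pair c (oflipCM c hc2 h T₀) - pair c (oflipCM c hc2 (h * g₁⁻¹) T₀) + pair c (oflipCM c hc2 (h * g₁⁻¹) T₁) - pair c T₁ ∈ L :=
    Submodule.sub_mem _ (Submodule.add_mem _ (Submodule.sub_mem _ (hP _) (hP _)) (hP _)) (hP _)
  have h2 := Submodule.sub_mem _ hpairs hW
  have e : ((Finsupp.single (oflipCM c hc2 h T₀) (1 : ℤ) - Finsupp.single T₀ 1) + (Finsupp.single (oflipCM c hc2 h T₁) (1 : ℤ) - Finsupp.single T₁ 1)) -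
      ((Finsupp.single (oflipCM c hc2 (h * g₁⁻¹) T₀) (1 : ℤ) - Finsupp.single T₀ 1) -
        (Finsupp.single (oflipCM c hc2 (h * g₁⁻¹) T₁) (1 : ℤ) - Finsupp.single T₁ 1)) =
      (pair c (oflipCM c hc2 h T₀) - pair c (oflipCM c hc2 (h * g₁⁻¹) T₀) + pair c (oflipCM c hc2 (h * g₁⁻¹) T₁) - pair c T₁) -
      (((Finsupp.single (oflipCM c hc2 (h * g₁⁻¹) T₀) (1 : ℤ) - Finsupp.single T₀ 1) -
          (Finsupp.single (oflipCM c hc2 (h * g₁⁻¹) T₁) (1 : ℤ) - Finsupp.single T₁ 1)) -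
        ((Finsupp.single (oflipCM c hc2 h T₀) (1 : ℤ) - Finsupp.single T₀ 1) + (Finsupp.single (oflipCM c hc2 h T₁) (1 : ℤ) - Finsupp.single T₁ 1)) +
        (pair c (oflipCM c hc2 h T₀) - pair c (oflipCM c hc2 (h * g₁⁻¹) T₀) + pair c (oflipCM c hc2 (h * g₁⁻¹) T₁) - pair c T₁)) := by
    abel
  rw [e]
  exact h2

end Frame

end

end Summit.HodgeConjecture.CorCM.Census.CentralSquares
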